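import Summits.BirchSwinnertonDyer.Rank1Residual.X12.O11.RouteUBernoulliCertificate
import Summits.BirchSwinnertonDyer.BirchSwinnertonDyer.Theorems.PrintCFramBottomClassIndexLawFiveLeRegularLocusBernoulliPairOdd
import Summits.BirchSwinnertonDyer.Rank1Residual.Additive.TameBranchTeichmuller
import Literature.NumberTheory.LFunctions.DworkRationalityDworkLemma
import Mathlib.Analysis.Normed.Group.Ultra
import HarnessLib

/-!
# Crux `PrintCFram.BottomClassIndexLawFiveLe` (stmt-BirchSwinnertonDyer-20372), line `eisenstein-resource-bdp-line`:
# the BERNOULLI SIDE OF THE LOCUS BOUNDARY, part I — certificate-free `p`-INTEGRALITY of `B_{1,χ}` in `ℚ_p`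
# (cell `bsd-print-cfram`, width seat `bsd-line-cfram-p1-w3` g3; THEOREMS ONLY, `--supports` 20372; BSD is not proved by any of this)

HONEST FRAMING. Nothing here is a statement about BSD; no stub of the skeleton is closed. Kriz–Li 2019 Thm. 1.20's
hypothesis (4) reads `¬ ‖B_{1,ψ₀⁻¹ε_K} · B_{1,ψ₀ω⁻¹}‖_p ≤ p⁻¹`; for an ODD `ψ` w2 g4 split it into a CLASS factor
`B_{1,ψ⁻¹}` and a `K''`-factor `B_{1,ψε_Kω⁻¹}` (`…RegularLocusBernoulliPairOdd`) and showed that a non-unit class factor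
kills (4) AS SOON AS the `K''`-factor is `p`-integral (`krizLi_bernoulli_hypothesis_fails_of_classFactor`, hypothesis
`hint : ‖B_{1,ψε_Kω⁻¹}‖ ≤ 1`). The tree's integrality lemma (`generalizedBernoulli_mem_subring`, Billerey–Menares
Lemma 3) needs `p ∤` level, which FAILS here (`ω` has level `p`). THIS FILE proves the integrality at levels
DIVISIBLE BY `p` ONCE, with no certificate:

* §0 `p`-adic plumbing: values of `ℚ_p`-valued Dirichlet characters are `p`-adic integers (`norm_apply_le_one`);
  RIGIDITY of `p`-adic roots of unity for odd `p` — `ζⁿ = 1 ∧ ‖ζ − 1‖ < 1 ⟹ ζ = 1` (`eq_one_of_pow_eq_one_of_norm_sub_one_lt`;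
  the prime-to-`p` exponent is the tree's `Rank1Residual.Additive.eq_one_of_pow_eq_one_of_norm_sub_one_lt_one`, the new
  content is the `p`-th roots: `(1+t)^p = 1 ∧ ‖t‖ < 1 ⟹ t = 0` by a second-order expansion of `∑_{i<p}(1+t)^i`),
  hence `ζ ≠ 1 ⟹ ‖ζ − 1‖ = 1` for character values (`norm_apply_sub_one_eq_one`).
* §1 the core estimate `‖∑_{j mod n} χ(j)·j‖_p ≤ p⁻¹` whenever `p ∣ n` and SOME unit `u` has `χ(u)·u ≢ 1 (mod p)`
  (reindex the sum by `j ↦ u·j`; `(u·j).val ≡ u.val·j.val (mod n)`).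
* §2 `‖B_{1,χ}‖_p ≤ 1`: at a level prime to `p` (trivially), and at a level `n` with `p ∥ n` under the unit
  hypothesis (`B_{1,χ} = (1/n)∑ χ(j) j`, `‖n‖ = p⁻¹`).
* Part II (`…BernoulliIntegralPrim`): tameness `p² ∤ conductor`, the master statement `‖bernoulliOnePrim χ‖_p ≤ 1` from ONE
  unit, and the Kriz–Li consequence (w2 g4's `hint` discharged).

beyond-print theorem: NO (Washington §5 / Kriz–Li Cor. 8.4-type integrality, elementary).
References: [Washington1997] Thm. 4.2, §5.1, Cor. 5.13, Cor. 5.15; [KrizLi2019] §1.5 (1), Thm. 1.20, §8 (35);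
[Gouvea1993PadicNumbers] §5.8 (roots of unity in `ℚ_p`).
-/

set_option autoImplicit false
set_option linter.dupNamespace false

noncomputable section

open scoped Classical
open DirichletCharacter Literature.NumberTheory.LFunctions Literature.NumberTheory.EllipticCurves.KrizLi2019
  Summit.BirchSwinnertonDyer.Rank1Residual.X12.O11.RouteU Summit.BirchSwinnertonDyer

namespace Summit.BirchSwinnertonDyer.BirchSwinnertonDyer.Theorems.PrintCFram.BernoulliIntegral

variable {p : ℕ} [hp : Fact p.Prime]

/-! ## §0 `p`-adic plumbing: character values are integral; rigidity of roots of unity -/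

/-- Values of a `ℚ_p`-valued Dirichlet character are `p`-adic integers (roots of unity or `0`).
[cite: Gouvea1993PadicNumbers, §5.8 (roots of unity in `ℤ_p^×`)] -/
theorem norm_apply_le_one {n : ℕ} (χ : DirichletCharacter ℚ_[p] n) (a : ZMod n) : ‖χ a‖ ≤ 1 := by
  by_cases ha : IsUnit a
  · obtain ⟨u, rfl⟩ := ha
    haveI : Fintype (ZMod n)ˣ := Fintype.ofFinite _
    have h1 : χ (u : ZMod n) ^ Fintype.card (ZMod n)ˣ = 1 := by
      rw [← map_pow, ← Units.val_pow_eq_pow_val, pow_card_eq_one, Units.val_one, map_one]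
    have h2 := congrArg (‖·‖) h1
    simp only [norm_pow, norm_one] at h2
    exact (pow_eq_one_iff_of_nonneg (norm_nonneg _) Fintype.card_ne_zero).mp h2 |>.le
  · rw [χ.map_nonunit ha, norm_zero]; exact zero_le_one

/-- A power of a principal unit is a principal unit: `‖ζ − 1‖ < 1 ⟹ ‖ζ^k − 1‖ < 1`. [folklore] -/
theorem norm_pow_sub_one_lt {ζ : ℚ_[p]} (h : ‖ζ - 1‖ < 1) (k : ℕ) : ‖ζ ^ k - 1‖ < 1 := by
  induction k with
  | zero => simp
  | succ k ih =>
    have hζ : ‖ζ‖ ≤ 1 := by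
      have := IsUltrametricDist.norm_add_le_max (ζ - 1) 1
      rw [sub_add_cancel, norm_one] at this
      exact this.trans (max_le h.le le_rfl)
    have e : ζ ^ (k + 1) - 1 = ζ * (ζ ^ k - 1) + (ζ - 1) := by ring
    rw [e]
    refine lt_of_le_of_lt (IsUltrametricDist.norm_add_le_max _ _) (max_lt ?_ h)
    rw [norm_mul]
    calc ‖ζ‖ * ‖ζ ^ k - 1‖ ≤ 1 * ‖ζ ^ k - 1‖ := mul_le_mul_of_nonneg_right hζ (norm_nonneg _)
      _ < 1 := by rw [one_mul]; exact ih

/-- Second-order binomial expansion in `ℤ_p`: `(1 + t)^i = 1 + i·t + t²·c`. (Mathlib `sq_dvd_add_pow_sub_sub`.) [folklore] -/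
theorem exists_one_add_pow_eq (t : ℤ_[p]) (i : ℕ) : ∃ c : ℤ_[p], (1 + t) ^ i = 1 + (i : ℤ_[p]) * t + t ^ 2 * c := by
  obtain ⟨c, hc⟩ := sq_dvd_add_pow_sub_sub t (1 : ℤ_[p]) i
  refine ⟨c, ?_⟩
  simp only [one_pow, one_mul] at hc
  linear_combination hc

/-- Second-order expansion of the geometric sum: `∑_{i<m} (1 + t)^i = m + t·(∑_{i<m} i) + t²·C`. [folklore] -/
theorem exists_geom_sum_one_add_eq (t : ℤ_[p]) (m : ℕ) :
    ∃ C : ℤ_[p], ∑ i ∈ Finset.range m, (1 + t) ^ i =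
      (m : ℤ_[p]) + t * ((∑ i ∈ Finset.range m, i : ℕ) : ℤ_[p]) + t ^ 2 * C := by
  induction m with
  | zero => exact ⟨0, by simp⟩
  | succ m ih =>
    obtain ⟨C, hC⟩ := ih
    obtain ⟨c, hc⟩ := exists_one_add_pow_eq t m
    refine ⟨C + c, ?_⟩
    rw [Finset.sum_range_succ, hC, hc, Finset.sum_range_succ]
    push_cast
    ring

/-- **Rigidity, the `p`-th roots (odd `p`)**: in `ℤ_p`, `(1 + t)^p = 1` with `‖t‖ < 1` forces `t = 0`.
(`(1+t)^p − 1 = t · ∑_{i<p}(1+t)^i` and `∑_{i<p}(1+t)^i = p·(1 + t·(p−1)/2) + t²·C` has norm EXACTLY `p⁻¹`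
when `p` is odd, while `t ≠ 0` would make it vanish.) [cite: Gouvea1993PadicNumbers, §5.8 (no `p`-th roots of unity in `ℚ_p`, `p` odd)] -/
theorem eq_zero_of_one_add_pow_prime_eq_one (hp2 : p ≠ 2) {t : ℤ_[p]} (ht : ‖t‖ < 1)
    (h : (1 + t) ^ p = 1) : t = 0 := by
  have hpp : p.Prime := hp.out
  -- `t · G = 0` with `G = ∑_{i<p} (1+t)^i`
  have hG : t * ∑ i ∈ Finset.range p, (1 + t) ^ i = 0 := by
    have := geom_sum_mul (1 + t) p
    rw [h, sub_self, add_sub_cancel_left] at this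
    rw [mul_comm]; exact this
  rcases mul_eq_zero.mp hG with h0 | hG0
  · exact h0
  exfalso
  obtain ⟨C, hC⟩ := exists_geom_sum_one_add_eq t p
  -- `∑_{i<p} i = p·((p−1)/2)` for `p` odd
  have hodd : Odd p := hpp.odd_of_ne_two hp2
  obtain ⟨k, hk⟩ : ∃ k : ℕ, p = 2 * k + 1 := hodd
  have hsum : (∑ i ∈ Finset.range p, i : ℕ) = p * k := by
    have h2 := Finset.sum_range_id_mul_two p
    rw [hk] at h2 ⊢
    have e : (2 * k + 1) * (2 * k + 1 - 1) = ((2 * k + 1) * k) * 2 := by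
      rw [Nat.add_sub_cancel]; ring
    rw [e] at h2
    exact Nat.eq_of_mul_eq_mul_right two_pos h2
  rw [hsum] at hC
  -- `G = p·(1 + t·k) + t²·C`
  have hG' : ∑ i ∈ Finset.range p, (1 + t) ^ i = (p : ℤ_[p]) * (1 + t * k) + t ^ 2 * C := by
    rw [hC]; push_cast; ring
  rw [hG0] at hG'
  -- norms: `‖p·(1 + t·k)‖ = p⁻¹`, `‖t²·C‖ ≤ p⁻²`
  have h1 : ‖(1 : ℤ_[p]) + t * k‖ = 1 := by
    have hlt : ‖t * (k : ℤ_[p])‖ < 1 := by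
      rw [norm_mul]
      calc ‖t‖ * ‖(k : ℤ_[p])‖ ≤ ‖t‖ * 1 := mul_le_mul_of_nonneg_left (PadicInt.norm_le_one _) (norm_nonneg _)
        _ < 1 := by rw [mul_one]; exact ht
    have hne : ‖(1 : ℤ_[p])‖ ≠ ‖t * (k : ℤ_[p])‖ := by rw [norm_one]; exact (ne_of_lt hlt).symm
    rw [PadicInt.norm_add_eq_max_of_ne hne, norm_one, max_eq_left hlt.le]
  have hL : ‖(p : ℤ_[p]) * (1 + t * k)‖ = (p : ℝ)⁻¹ := by rw [norm_mul, PadicInt.norm_p, h1, mul_one]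
  have hR : ‖t ^ 2 * C‖ ≤ (p : ℝ)⁻¹ * (p : ℝ)⁻¹ := by
    rw [norm_mul, norm_pow, sq]
    calc ‖t‖ * ‖t‖ * ‖C‖ ≤ ‖t‖ * ‖t‖ * 1 := mul_le_mul_of_nonneg_left (PadicInt.norm_le_one _) (by positivity)
      _ ≤ (p : ℝ)⁻¹ * (p : ℝ)⁻¹ * 1 := by
          have := Dwork.PadicInt.norm_le_inv_of_norm_lt_one ht
          gcongr
      _ = _ := mul_one _
  have heq : (p : ℤ_[p]) * (1 + t * k) = -(t ^ 2 * C) := eq_neg_of_add_eq_zero_left hG'.symm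
  rw [heq, norm_neg] at hL
  rw [hL] at hR
  have hp0 : (0 : ℝ) < (p : ℝ)⁻¹ := by have := hpp.pos; positivity
  have hp1 : (p : ℝ)⁻¹ < 1 := inv_lt_one_of_one_lt₀ (by exact_mod_cast hpp.one_lt)
  nlinarith

/-- **Rigidity of `p`-adic roots of unity (odd `p`)**: `ζⁿ = 1`, `n ≠ 0`, `‖ζ − 1‖_p < 1 ⟹ ζ = 1`. Equivalently: the roots
of unity of `ℚ_p` are pairwise incongruent modulo `p` (they are the `(p−1)`-th roots of unity). [cite: Gouvea1993PadicNumbers, §5.8 (Cor. 5.8.2)] [cite: Washington1997, §5.1] -/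
theorem eq_one_of_pow_eq_one_of_norm_sub_one_lt (hp2 : p ≠ 2) {ζ : ℚ_[p]} :
    ∀ {n : ℕ}, n ≠ 0 → ζ ^ n = 1 → ‖ζ - 1‖ < 1 → ζ = 1 := by
  intro n
  induction n using Nat.strong_induction_on with
  | _ n ih =>
    intro hn hζ h
    by_cases hpn : p ∣ n
    · obtain ⟨m, rfl⟩ := hpn
      have hm : m ≠ 0 := by rintro rfl; exact hn (mul_zero p)
      have hmlt : m < p * m := lt_mul_left (Nat.pos_of_ne_zero hm) hp.out.one_lt
      -- `η = ζ^m` is a `p`-th root of unity congruent to `1`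
      have hη1 : ‖ζ ^ m - 1‖ < 1 := norm_pow_sub_one_lt h m
      have hηle : ‖ζ ^ m - 1‖ ≤ 1 := hη1.le
      set t : ℤ_[p] := ⟨ζ ^ m - 1, hηle⟩ with ht
      have htn : ‖t‖ < 1 := hη1
      have htp : (1 + t) ^ p = 1 := by
        apply Subtype.ext
        change ((1 : ℤ_[p]) + t : ℚ_[p]) ^ p = 1
        push_cast
        rw [ht]
        change (1 + (ζ ^ m - 1)) ^ p = 1
        rw [add_sub_cancel, ← pow_mul, mul_comm, hζ]
      have ht0 := eq_zero_of_one_add_pow_prime_eq_one hp2 htn htp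
      have hηm : ζ ^ m = 1 := by
        have : ((t : ℤ_[p]) : ℚ_[p]) = 0 := by rw [ht0]; rfl
        rw [ht] at this
        change ζ ^ m - 1 = 0 at this
        exact sub_eq_zero.mp this
      exact ih m hmlt hm hηm h
    · exact Rank1Residual.Additive.eq_one_of_pow_eq_one_of_norm_sub_one_lt_one hpn hζ h

/-- **Distinct roots of unity of `ℚ_p` are incongruent mod `p`**: `ζⁿ = 1`, `ζ ≠ 1` (odd `p`) ⟹ `‖ζ − 1‖_p = 1`.
[cite: Gouvea1993PadicNumbers, §5.8 (Cor. 5.8.2)] -/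
theorem norm_sub_one_eq_one_of_pow_eq_one (hp2 : p ≠ 2) {ζ : ℚ_[p]} {n : ℕ} (hn : n ≠ 0) (hζ : ζ ^ n = 1)
    (hne : ζ ≠ 1) : ‖ζ - 1‖ = 1 := by
  have hζ1 : ‖ζ‖ ≤ 1 := by
    have h2 := congrArg (‖·‖) hζ
    simp only [norm_pow, norm_one] at h2
    exact ((pow_eq_one_iff_of_nonneg (norm_nonneg _) hn).mp h2).le
  have hle : ‖ζ - 1‖ ≤ 1 := by
    refine (IsUltrametricDist.norm_add_le_max ζ (-1)).trans ?_ |> fun h => by rw [← sub_eq_add_neg] at h; exact h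
    rw [norm_neg, norm_one]; exact max_le hζ1 le_rfl
  exact le_antisymm hle (not_lt.mp fun hlt => hne (eq_one_of_pow_eq_one_of_norm_sub_one_lt hp2 hn hζ hlt))

/-- **For character values**: `χ(u) ≠ 1 ⟹ ‖χ(u) − 1‖_p = 1` (odd `p`), `u` a unit of the level.
[cite: Washington1997, §5.1 (ω(a) ≡ a mod p determines the root of unity)] -/
theorem norm_apply_sub_one_eq_one (hp2 : p ≠ 2) {n : ℕ} (χ : DirichletCharacter ℚ_[p] n) (u : (ZMod n)ˣ)
    (hu : χ (u : ZMod n) ≠ 1) : ‖χ (u : ZMod n) - 1‖ = 1 := by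
  haveI : Fintype (ZMod n)ˣ := Fintype.ofFinite _
  have h1 : χ (u : ZMod n) ^ Fintype.card (ZMod n)ˣ = 1 := by
    rw [← map_pow, ← Units.val_pow_eq_pow_val, pow_card_eq_one, Units.val_one, map_one]
  exact norm_sub_one_eq_one_of_pow_eq_one hp2 Fintype.card_ne_zero h1 hu


/-! ## §1 The core estimate: `‖∑_{j mod n} χ(j)·j‖_p ≤ p⁻¹` from ONE unit with `χ(u)·u ≢ 1 (mod p)` -/

/-- `(u·j).val ≡ u.val·j.val (mod n)`, read `p`-adically at a level divisible by `p`: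
`‖(u·j).val − u.val·j.val‖_p ≤ p⁻¹`. [folklore] -/
theorem norm_val_mul_sub_le {n : ℕ} [NeZero n] (hpn : p ∣ n) (u j : ZMod n) :
    ‖(((u * j).val : ℕ) : ℚ_[p]) - ((u.val : ℕ) : ℚ_[p]) * ((j.val : ℕ) : ℚ_[p])‖ ≤ (p : ℝ)⁻¹ := by
  have hmod : (u * j).val = (u.val * j.val) % n := ZMod.val_mul u j
  have hdvd : (n : ℤ) ∣ ((u * j).val : ℤ) - (u.val : ℤ) * (j.val : ℤ) := by
    have hc : (((u.val * j.val % n : ℕ) : ℤ)) = ((u.val * j.val : ℕ) : ℤ) % (n : ℤ) := Int.natCast_mod _ _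
    rw [hmod, hc, Int.emod_def]
    exact ⟨-((((u.val * j.val : ℕ) : ℤ)) / (n : ℤ)), by push_cast; ring⟩
  have hdvdp : (p : ℤ) ∣ ((u * j).val : ℤ) - (u.val : ℤ) * (j.val : ℤ) :=
    dvd_trans (Int.natCast_dvd_natCast.mpr hpn) hdvd
  have h := (Padic.norm_int_le_pow_iff_dvd (((u * j).val : ℤ) - (u.val : ℤ) * (j.val : ℤ)) 1).mpr
    (by simpa using hdvdp)
  push_cast at h
  simpa using h

/-- **The core estimate.** Let `χ` be a `ℚ_p`-valued Dirichlet character of level `n`, `p ∣ n`, and suppose SOME unit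
`u` of `ℤ/n` has `χ(u)·u ≢ 1 (mod p)` (`‖χ(u)·u.val − 1‖_p = 1`). Then `∑_{j mod n} χ(j)·j ≡ 0 (mod p)`:
reindexing by `j ↦ u·j` multiplies the sum by `χ(u)·u` modulo `p`. [cite: Washington1997, §5.1 and Thm. 4.2 (the sums `∑ χ(a) a`)] -/
theorem norm_sum_mul_val_le_inv_of_unit {n : ℕ} [NeZero n] (χ : DirichletCharacter ℚ_[p] n) (hpn : p ∣ n)
    (u : (ZMod n)ˣ) (hu : ‖χ (u : ZMod n) * (((u : ZMod n).val : ℕ) : ℚ_[p]) - 1‖ = 1) :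
    ‖∑ j : ZMod n, χ j * ((j.val : ℕ) : ℚ_[p])‖ ≤ (p : ℝ)⁻¹ := by
  set S : ℚ_[p] := ∑ j : ZMod n, χ j * ((j.val : ℕ) : ℚ_[p]) with hS
  -- reindex by `j ↦ u·j`
  have hre : S = ∑ j : ZMod n, χ ((u : ZMod n) * j) * ((((u : ZMod n) * j).val : ℕ) : ℚ_[p]) := by
    rw [hS]
    exact (Fintype.sum_equiv (u.mulLeft) _ _ (fun j => rfl)).symm
  -- error term
  set E : ℚ_[p] := ∑ j : ZMod n, χ ((u : ZMod n) * j) *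
      (((((u : ZMod n) * j).val : ℕ) : ℚ_[p]) - (((u : ZMod n).val : ℕ) : ℚ_[p]) * ((j.val : ℕ) : ℚ_[p])) with hE
  have hE1 : ‖E‖ ≤ (p : ℝ)⁻¹ := by
    refine IsUltrametricDist.norm_sum_le_of_forall_le_of_nonneg (by positivity) fun j _ => ?_
    rw [norm_mul]
    calc ‖χ ((u : ZMod n) * j)‖ * _ ≤ 1 * (p : ℝ)⁻¹ :=
          mul_le_mul (norm_apply_le_one χ _) (norm_val_mul_sub_le hpn _ _) (norm_nonneg _) zero_le_one
      _ = (p : ℝ)⁻¹ := one_mul _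
  -- `S = χ(u)·u.val·S + E`
  have hkey : S = χ (u : ZMod n) * (((u : ZMod n).val : ℕ) : ℚ_[p]) * S + E := by
    calc S = ∑ j : ZMod n, χ ((u : ZMod n) * j) * ((((u : ZMod n) * j).val : ℕ) : ℚ_[p]) := hre
      _ = ∑ j : ZMod n, (χ (u : ZMod n) * (((u : ZMod n).val : ℕ) : ℚ_[p]) * (χ j * ((j.val : ℕ) : ℚ_[p])) +
            χ ((u : ZMod n) * j) *
              (((((u : ZMod n) * j).val : ℕ) : ℚ_[p]) - (((u : ZMod n).val : ℕ) : ℚ_[p]) * ((j.val : ℕ) : ℚ_[p]))) :=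
          Finset.sum_congr rfl fun j _ => by rw [map_mul]; ring
      _ = χ (u : ZMod n) * (((u : ZMod n).val : ℕ) : ℚ_[p]) * S + E := by
          rw [Finset.sum_add_distrib, ← Finset.mul_sum, ← hS, ← hE]
  have hfac : (χ (u : ZMod n) * (((u : ZMod n).val : ℕ) : ℚ_[p]) - 1) * S = -E := by
    linear_combination (-1 : ℚ_[p]) * hkey
  have hn := congrArg (‖·‖) hfac
  simp only [norm_mul, hu, one_mul, norm_neg] at hn
  rw [hn]; exact hE1

/-! ## §2 `‖B_{1,χ}‖_p ≤ 1` at a level prime to `p`, and at a level exactly divisible by `p` -/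

/-- **Level prime to `p`**: for `χ ≠ 1` of level `n` with `p ∤ n`, `B_{1,χ} = (1/n)∑ χ(j) j` is `p`-integral.
[cite: Washington1997, Thm. 4.2 and §5.1] [cite: KrizLi2019, §1.5 display (1) (p. 7)] -/
theorem norm_generalizedBernoulli_one_le_one_of_not_dvd {n : ℕ} [NeZero n] (χ : DirichletCharacter ℚ_[p] n)
    (hχ : χ ≠ 1) (hpn : ¬ p ∣ n) : ‖generalizedBernoulli 1 χ‖ ≤ 1 := by
  rw [generalizedBernoulli_one_eq_sum_div χ hχ, norm_div,
    Padic.norm_natCast_eq_one_iff.mpr ((Nat.Prime.coprime_iff_not_dvd hp.out).mpr hpn), div_one]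
  refine IsUltrametricDist.norm_sum_le_of_forall_le_of_nonneg zero_le_one fun j _ => ?_
  rw [norm_mul]
  exact mul_le_one₀ (norm_apply_le_one χ j) (norm_nonneg _) (by exact_mod_cast Padic.norm_int_le_one (j.val : ℤ))

/-- **Level exactly divisible by `p`**: for `χ` of level `n` with `ord_p n = 1` and a unit `u` with
`χ(u)·u ≢ 1 (mod p)`, `B_{1,χ}` is `p`-integral (`‖∑ χ(j) j‖ ≤ p⁻¹ = ‖n‖`). [cite: Washington1997, Thm. 4.2 and §5.1] [cite: KrizLi2019, §1.5 display (1) (p. 7) and §8 (35)] -/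
theorem norm_generalizedBernoulli_one_le_one_of_unit {n : ℕ} [NeZero n] (χ : DirichletCharacter ℚ_[p] n)
    (hχ : χ ≠ 1) (hn : padicValNat p n = 1) (u : (ZMod n)ˣ)
    (hu : ‖χ (u : ZMod n) * (((u : ZMod n).val : ℕ) : ℚ_[p]) - 1‖ = 1) : ‖generalizedBernoulli 1 χ‖ ≤ 1 := by
  have hpn : p ∣ n := by
    by_contra h
    rw [padicValNat.eq_zero_of_not_dvd h] at hn
    exact zero_ne_one hn
  rw [generalizedBernoulli_one_eq_sum_div χ hχ, norm_div,
    norm_natCast_eq_inv_of_padicValNat_eq_one hn]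
  rw [div_le_one (by have := hp.out.pos; positivity)]
  exact norm_sum_mul_val_le_inv_of_unit χ hpn u hu

end Summit.BirchSwinnertonDyer.BirchSwinnertonDyer.Theorems.PrintCFram.BernoulliIntegral

end
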